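import Mathlib
import Summits.Ventures.PercRepro2.CoinChainXAClosedGate

/-!
# The CLOSED GATE of (XA′) for GENERAL markers — region sums and Holley facts
(blind cell PercRepro2, night-2 g30)

Infrastructure for CoinChainXAClosedGateGen.lean: the weighted closed-gate moments for an
arbitrary marker (`cg_mom0`, `cg_mom1`, `cg_mom0c`, `cg_mom1c`), the `ent`-free piecewise law
`(νc on the ideal, ν(c − d) on the coin-entered clusters)` and its splits, and the Holley facts of
the parts model with the ideal's marker mass inside the down-set `𝒥` (`cg_fact_JU'`, `cg_fact_JM'`),
the generic Holley facts for the `(c, d)` and `(c, c)` law pairs on cells with given meets and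
joins (`cg_fact_cd`, `cg_fact_cc` — used for `I ≼ 𝒰`, `I ≼ M`, `I ≼ D′`, `Mᶜ ≼ M`), and FKG on the
ideal (`cg_fact_fkg_ideal`).
-/

namespace Summit.Ventures.PercRepro2.Coin

open Classical

section ClosedGateGenSums

variable {V : Type*} [DecidableEq V] {R : Type*} [Field R]
variable (U ent ent' : Finset V) (ν c d : Finset V → R)

/-- The weighted coin-closed moment: `Σ_I νcz + Σ_D νcz + Σ_M νdz`. -/
theorem cg_mom0 (z : Finset V → R) :
    ∑ W ∈ U.powerset, ν W * chainMix ent ent' 0 c d W * z W =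
      (∑ W ∈ U.powerset.filter (fun W => ¬ ∃ r ∈ ent ∪ ent', r ∈ W), ν W * c W * z W)
      + (∑ W ∈ U.powerset.filter (fun W => (¬ ∃ r ∈ ent, r ∈ W) ∧ ∃ r ∈ ent', r ∈ W), ν W * c W * z W)
      + (∑ W ∈ U.powerset.filter (fun W => ∃ r ∈ ent, r ∈ W), ν W * d W * z W) := by
  rw [sum_three_regions U ent ent']
  congr 1
  congr 1
  · exact Finset.sum_congr rfl (fun W hW => by
      rw [cgate_mix0_c ent ent' c d (cgate_not_meet_ent (Finset.mem_filter.1 hW).2)])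
  · exact Finset.sum_congr rfl (fun W hW => by rw [cgate_mix0_c ent ent' c d (Finset.mem_filter.1 hW).2.1])
  · exact Finset.sum_congr rfl (fun W hW => by rw [cgate_mix0_d ent ent' c d (Finset.mem_filter.1 hW).2])

/-- The weighted coin-open moment: `Σ_I νcz + Σ_D νdz + Σ_M νdz`. -/
theorem cg_mom1 (z : Finset V → R) :
    ∑ W ∈ U.powerset, ν W * chainMix ent ent' 1 c d W * z W =
      (∑ W ∈ U.powerset.filter (fun W => ¬ ∃ r ∈ ent ∪ ent', r ∈ W), ν W * c W * z W)
      + (∑ W ∈ U.powerset.filter (fun W => (¬ ∃ r ∈ ent, r ∈ W) ∧ ∃ r ∈ ent', r ∈ W), ν W * d W * z W)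
      + (∑ W ∈ U.powerset.filter (fun W => ∃ r ∈ ent, r ∈ W), ν W * d W * z W) := by
  rw [sum_three_regions U ent ent']
  congr 1
  congr 1
  · exact Finset.sum_congr rfl (fun W hW => by rw [cgate_mix1_c ent ent' c d (Finset.mem_filter.1 hW).2])
  · exact Finset.sum_congr rfl (fun W hW => by
      rw [cgate_mix1_d ent ent' c d (cgate_meet_of_ent' (Finset.mem_filter.1 hW).2.2)])
  · exact Finset.sum_congr rfl (fun W hW => by
      rw [cgate_mix1_d ent ent' c d (cgate_meet_of_ent (Finset.mem_filter.1 hW).2)])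

/-- The weighted closed world-0 gate moment: `Σ_I νcz + Σ_D νcz`. -/
theorem cg_mom0c (z : Finset V → R) :
    ∑ W ∈ U.powerset, ν W * chainMix ent ent' 0 c (fun _ => (0 : R)) W * z W =
      (∑ W ∈ U.powerset.filter (fun W => ¬ ∃ r ∈ ent ∪ ent', r ∈ W), ν W * c W * z W)
      + (∑ W ∈ U.powerset.filter (fun W => (¬ ∃ r ∈ ent, r ∈ W) ∧ ∃ r ∈ ent', r ∈ W), ν W * c W * z W) := by
  rw [sum_three_regions U ent ent']
  have h3 : ∑ W ∈ U.powerset.filter (fun W => ∃ r ∈ ent, r ∈ W),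
      ν W * chainMix ent ent' 0 c (fun _ => (0 : R)) W * z W = 0 :=
    cgate_sum_zero U _ _ (fun W hW => by rw [cgate_mix0_d ent ent' c _ hW, mul_zero, zero_mul])
  rw [h3, add_zero]
  congr 1
  · exact Finset.sum_congr rfl (fun W hW => by
      rw [cgate_mix0_c ent ent' c _ (cgate_not_meet_ent (Finset.mem_filter.1 hW).2)])
  · exact Finset.sum_congr rfl (fun W hW => by rw [cgate_mix0_c ent ent' c _ (Finset.mem_filter.1 hW).2.1])

/-- The weighted closed world-1 gate moment: `Σ_I νcz`. -/
theorem cg_mom1c (z : Finset V → R) :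
    ∑ W ∈ U.powerset, ν W * chainMix ent ent' 1 c (fun _ => (0 : R)) W * z W =
      ∑ W ∈ U.powerset.filter (fun W => ¬ ∃ r ∈ ent ∪ ent', r ∈ W), ν W * c W * z W := by
  rw [sum_three_regions U ent ent']
  have h2 : ∑ W ∈ U.powerset.filter (fun W => (¬ ∃ r ∈ ent, r ∈ W) ∧ ∃ r ∈ ent', r ∈ W),
      ν W * chainMix ent ent' 1 c (fun _ => (0 : R)) W * z W = 0 :=
    cgate_sum_zero U _ _ (fun W hW => by
      rw [cgate_mix1_d ent ent' c _ (cgate_meet_of_ent' hW.2), mul_zero, zero_mul])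
  have h3 : ∑ W ∈ U.powerset.filter (fun W => ∃ r ∈ ent, r ∈ W),
      ν W * chainMix ent ent' 1 c (fun _ => (0 : R)) W * z W = 0 :=
    cgate_sum_zero U _ _ (fun W hW => by
      rw [cgate_mix1_d ent ent' c _ (cgate_meet_of_ent hW), mul_zero, zero_mul])
  rw [h2, h3, add_zero, add_zero]
  exact Finset.sum_congr rfl (fun W hW => by rw [cgate_mix1_c ent ent' c _ (Finset.mem_filter.1 hW).2])

/-- The `ent`-free law `(νc on the ideal, ν(c − d) on the coin-entered clusters)` as one filtered
sum splits into the two region sums. -/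
theorem cg_entfree_piecewise (z : Finset V → R) :
    ∑ W ∈ U.powerset.filter (fun W => ¬ ∃ r ∈ ent, r ∈ W),
        ν W * (if ∃ r ∈ ent', r ∈ W then c W - d W else c W) * z W =
      (∑ W ∈ U.powerset.filter (fun W => ¬ ∃ r ∈ ent ∪ ent', r ∈ W), ν W * c W * z W)
      + (∑ W ∈ U.powerset.filter (fun W => (¬ ∃ r ∈ ent, r ∈ W) ∧ ∃ r ∈ ent', r ∈ W), ν W * (c W - d W) * z W) := by
  rw [sum_entfree_split U ent ent']
  congr 1
  · exact Finset.sum_congr rfl (fun W hW => by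
      have h : ¬ ∃ r ∈ ent', r ∈ W := fun h' => (Finset.mem_filter.1 hW).2 (cgate_meet_of_ent' h')
      rw [if_neg h])
  · exact Finset.sum_congr rfl (fun W hW => by rw [if_pos (Finset.mem_filter.1 hW).2.2])

/-- The `ent`-free piecewise law's mass splits into `a + δ`. -/
theorem cg_entfree_piecewise' :
    ∑ W ∈ U.powerset.filter (fun W => ¬ ∃ r ∈ ent, r ∈ W),
        ν W * (if ∃ r ∈ ent', r ∈ W then c W - d W else c W) =
      (∑ W ∈ U.powerset.filter (fun W => ¬ ∃ r ∈ ent ∪ ent', r ∈ W), ν W * c W)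
      + (∑ W ∈ U.powerset.filter (fun W => (¬ ∃ r ∈ ent, r ∈ W) ∧ ∃ r ∈ ent', r ∈ W), ν W * (c W - d W)) := by
  rw [sum_entfree_split U ent ent']
  congr 1
  · exact Finset.sum_congr rfl (fun W hW => by
      have h : ¬ ∃ r ∈ ent', r ∈ W := fun h' => (Finset.mem_filter.1 hW).2 (cgate_meet_of_ent' h')
      rw [if_neg h])
  · exact Finset.sum_congr rfl (fun W hW => by rw [if_pos (Finset.mem_filter.1 hW).2.2])

end ClosedGateGenSums

section ClosedGateGenFacts

variable {V : Type*} [DecidableEq V] {R : Type*} [Field R] [LinearOrder R] [IsStrictOrderedRing R]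
variable (U ent ent' : Finset V) (ν c d : Finset V → R)
variable (hν0 : ∀ W, 0 ≤ ν W) (hν : ∀ s ⊆ U, ∀ t ⊆ U, ν s * ν t ≤ ν (s ∩ t) * ν (s ∪ t))
  (hc0 : ∀ W, 0 ≤ c W) (hd0 : ∀ W, 0 ≤ d W) (hdc : ∀ W, d W ≤ c W)
  (hcc : ∀ s t, c s * c t ≤ c (s ∩ t) * c (s ∪ t))
  (hcd : ∀ s t, c s * d t ≤ c (s ∩ t) * d (s ∪ t))
  (hratio : ∀ s t, s ⊆ t → d s * c t ≤ c s * d t)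
  (x y : Finset V → R) (hx0 : ∀ W, 0 ≤ x W) (hy0 : ∀ W, 0 ≤ y W)
  (hxm : ∀ s t, x s ≤ x (s ∪ t)) (hym : ∀ s t, y s ≤ y (s ∪ t))

include hc0 hd0 hdc hcd hratio in
/-- The pointwise Holley inequality of the `ent`-free piecewise law against the coin law. -/
lemma cg_piece_pw (s t : Finset V) :
    (if ∃ r ∈ ent', r ∈ s then c s - d s else c s) * d t ≤
      (if ∃ r ∈ ent', r ∈ s ∩ t then c (s ∩ t) - d (s ∩ t) else c (s ∩ t)) * d (s ∪ t) := by
  by_cases h1 : ∃ r ∈ ent', r ∈ s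
  · rw [if_pos h1]
    by_cases h2 : ∃ r ∈ ent', r ∈ s ∩ t
    · rw [if_pos h2]; exact closed_gate_pw c d hc0 hd0 hdc hcd hratio s t
    · rw [if_neg h2]
      exact le_trans (closed_gate_pw c d hc0 hd0 hdc hcd hratio s t)
        (mul_le_mul_of_nonneg_right (by linarith [hd0 (s ∩ t)]) (hd0 _))
  · rw [if_neg h1]
    have h2 : ¬ ∃ r ∈ ent', r ∈ s ∩ t := fun ⟨r, hr, hrW⟩ => h1 ⟨r, hr, (Finset.mem_inter.1 hrW).1⟩
    rw [if_neg h2]; exact hcd s t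

include hν0 hν hc0 hd0 hdc hcd hratio hx0 hxm in
/-- **The down-set `𝒥` (ideal + killed part) is Holley-below the surviving part**, with the
ideal's marker mass included. -/
theorem cg_fact_JU' :
    (∑ W ∈ U.powerset.filter (fun W => ¬ ∃ r ∈ ent, r ∈ W), ν W * (if ∃ r ∈ ent', r ∈ W then c W - d W else c W) * x W)
      * (∑ W ∈ U.powerset.filter (fun W => (¬ ∃ r ∈ ent, r ∈ W) ∧ ∃ r ∈ ent', r ∈ W), ν W * d W) ≤
    (∑ W ∈ U.powerset.filter (fun W => ¬ ∃ r ∈ ent, r ∈ W), ν W * (if ∃ r ∈ ent', r ∈ W then c W - d W else c W))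
      * (∑ W ∈ U.powerset.filter (fun W => (¬ ∃ r ∈ ent, r ∈ W) ∧ ∃ r ∈ ent', r ∈ W), ν W * d W * x W) := by
  have hpw0 : ∀ W, 0 ≤ (if ∃ r ∈ ent', r ∈ W then c W - d W else c W) := fun W => by
    split_ifs <;> linarith [hdc W, hc0 W]
  refine ad_sets_dec U (fun W => ν W * (if ∃ r ∈ ent', r ∈ W then c W - d W else c W) * x W) (fun W => ν W * d W)
    (fun W => ν W * (if ∃ r ∈ ent', r ∈ W then c W - d W else c W)) (fun W => ν W * d W * x W)
    (fun W => mul_nonneg (mul_nonneg (hν0 W) (hpw0 W)) (hx0 W))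
    (fun W => mul_nonneg (hν0 W) (hd0 W)) (fun W => mul_nonneg (hν0 W) (hpw0 W))
    (fun W => mul_nonneg (mul_nonneg (hν0 W) (hd0 W)) (hx0 W))
    (fun W => ¬ ∃ r ∈ ent, r ∈ W) (fun W => (¬ ∃ r ∈ ent, r ∈ W) ∧ ∃ r ∈ ent', r ∈ W)
    (fun W => ¬ ∃ r ∈ ent, r ∈ W) (fun W => (¬ ∃ r ∈ ent, r ∈ W) ∧ ∃ r ∈ ent', r ∈ W) ?_
  intro s hs t ht hA hB
  refine ⟨fun ⟨r, hr, hrW⟩ => hA ⟨r, hr, (Finset.mem_inter.1 hrW).1⟩,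
    ⟨fun ⟨r, hr, hrW⟩ => (Finset.mem_union.1 hrW).elim (fun h => hA ⟨r, hr, h⟩) (fun h => hB.1 ⟨r, hr, h⟩),
      by obtain ⟨r, hr, hrW⟩ := hB.2; exact ⟨r, hr, Finset.mem_union.2 (Or.inr hrW)⟩⟩, ?_⟩
  calc ν s * (if ∃ r ∈ ent', r ∈ s then c s - d s else c s) * x s * (ν t * d t)
      = (ν s * ν t) * ((if ∃ r ∈ ent', r ∈ s then c s - d s else c s) * d t) * x s := by ring
    _ ≤ (ν (s ∩ t) * ν (s ∪ t)) * ((if ∃ r ∈ ent', r ∈ s ∩ t then c (s ∩ t) - d (s ∩ t) else c (s ∩ t)) * d (s ∪ t)) * x (s ∪ t) :=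
        cg_mul3_le (hν s hs t ht) (cg_piece_pw ent' c d hc0 hd0 hdc hcd hratio s t) (hxm s t)
          (mul_nonneg (hpw0 s) (hd0 t)) (hx0 s) (mul_nonneg (hν0 _) (hν0 _))
          (mul_nonneg (hpw0 _) (hd0 _))
    _ = ν (s ∩ t) * (if ∃ r ∈ ent', r ∈ s ∩ t then c (s ∩ t) - d (s ∩ t) else c (s ∩ t)) * (ν (s ∪ t) * d (s ∪ t) * x (s ∪ t)) := by ring

include hν0 hν hc0 hd0 hdc hcd hratio hx0 hxm in
/-- **The down-set `𝒥` is Holley-below the sure-entered clusters**, with the ideal's marker mass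
included. -/
theorem cg_fact_JM' :
    (∑ W ∈ U.powerset.filter (fun W => ¬ ∃ r ∈ ent, r ∈ W), ν W * (if ∃ r ∈ ent', r ∈ W then c W - d W else c W) * x W)
      * (∑ W ∈ U.powerset.filter (fun W => ∃ r ∈ ent, r ∈ W), ν W * d W) ≤
    (∑ W ∈ U.powerset.filter (fun W => ¬ ∃ r ∈ ent, r ∈ W), ν W * (if ∃ r ∈ ent', r ∈ W then c W - d W else c W))
      * (∑ W ∈ U.powerset.filter (fun W => ∃ r ∈ ent, r ∈ W), ν W * d W * x W) := by
  have hpw0 : ∀ W, 0 ≤ (if ∃ r ∈ ent', r ∈ W then c W - d W else c W) := fun W => by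
    split_ifs <;> linarith [hdc W, hc0 W]
  refine ad_sets_dec U (fun W => ν W * (if ∃ r ∈ ent', r ∈ W then c W - d W else c W) * x W) (fun W => ν W * d W)
    (fun W => ν W * (if ∃ r ∈ ent', r ∈ W then c W - d W else c W)) (fun W => ν W * d W * x W)
    (fun W => mul_nonneg (mul_nonneg (hν0 W) (hpw0 W)) (hx0 W))
    (fun W => mul_nonneg (hν0 W) (hd0 W)) (fun W => mul_nonneg (hν0 W) (hpw0 W))
    (fun W => mul_nonneg (mul_nonneg (hν0 W) (hd0 W)) (hx0 W))
    (fun W => ¬ ∃ r ∈ ent, r ∈ W) (fun W => ∃ r ∈ ent, r ∈ W)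
    (fun W => ¬ ∃ r ∈ ent, r ∈ W) (fun W => ∃ r ∈ ent, r ∈ W) ?_
  intro s hs t ht hA hB
  refine ⟨fun ⟨r, hr, hrW⟩ => hA ⟨r, hr, (Finset.mem_inter.1 hrW).1⟩,
    by obtain ⟨r, hr, hrW⟩ := hB; exact ⟨r, hr, Finset.mem_union.2 (Or.inr hrW)⟩, ?_⟩
  calc ν s * (if ∃ r ∈ ent', r ∈ s then c s - d s else c s) * x s * (ν t * d t)
      = (ν s * ν t) * ((if ∃ r ∈ ent', r ∈ s then c s - d s else c s) * d t) * x s := by ring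
    _ ≤ (ν (s ∩ t) * ν (s ∪ t)) * ((if ∃ r ∈ ent', r ∈ s ∩ t then c (s ∩ t) - d (s ∩ t) else c (s ∩ t)) * d (s ∪ t)) * x (s ∪ t) :=
        cg_mul3_le (hν s hs t ht) (cg_piece_pw ent' c d hc0 hd0 hdc hcd hratio s t) (hxm s t)
          (mul_nonneg (hpw0 s) (hd0 t)) (hx0 s) (mul_nonneg (hν0 _) (hν0 _))
          (mul_nonneg (hpw0 _) (hd0 _))
    _ = ν (s ∩ t) * (if ∃ r ∈ ent', r ∈ s ∩ t then c (s ∩ t) - d (s ∩ t) else c (s ∩ t)) * (ν (s ∪ t) * d (s ∪ t) * x (s ∪ t)) := by ring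

include hν0 hν hc0 hd0 hcd hx0 hxm in
/-- **A generic Holley fact** `L₁(A)·νd(B) ≤ νc(A′)·νdx(B′)` for `A = {P}`, `B = {Q}` with the
meets in `{P'}` and the joins in `{Q'}`, the first law `νc·x`. -/
theorem cg_fact_cd (P Q P' Q' : Finset V → Prop) [DecidablePred P] [DecidablePred Q]
    [DecidablePred P'] [DecidablePred Q']
    (h : ∀ s ⊆ U, ∀ t ⊆ U, P s → Q t → P' (s ∩ t) ∧ Q' (s ∪ t)) :
    (∑ W ∈ U.powerset.filter P, ν W * c W * x W) * (∑ W ∈ U.powerset.filter Q, ν W * d W) ≤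
      (∑ W ∈ U.powerset.filter P', ν W * c W) * (∑ W ∈ U.powerset.filter Q', ν W * d W * x W) := by
  refine ad_sets_dec U (fun W => ν W * c W * x W) (fun W => ν W * d W) (fun W => ν W * c W)
    (fun W => ν W * d W * x W)
    (fun W => mul_nonneg (mul_nonneg (hν0 W) (hc0 W)) (hx0 W)) (fun W => mul_nonneg (hν0 W) (hd0 W))
    (fun W => mul_nonneg (hν0 W) (hc0 W)) (fun W => mul_nonneg (mul_nonneg (hν0 W) (hd0 W)) (hx0 W))
    P Q P' Q' ?_
  intro s hs t ht hA hB
  refine ⟨(h s hs t ht hA hB).1, (h s hs t ht hA hB).2, ?_⟩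
  calc ν s * c s * x s * (ν t * d t) = (ν s * ν t) * (c s * d t) * x s := by ring
    _ ≤ (ν (s ∩ t) * ν (s ∪ t)) * (c (s ∩ t) * d (s ∪ t)) * x (s ∪ t) :=
        cg_mul3_le (hν s hs t ht) (hcd s t) (hxm s t) (mul_nonneg (hc0 s) (hd0 t)) (hx0 s)
          (mul_nonneg (hν0 _) (hν0 _)) (mul_nonneg (hc0 _) (hd0 _))
    _ = ν (s ∩ t) * c (s ∩ t) * (ν (s ∪ t) * d (s ∪ t) * x (s ∪ t)) := by ring

include hν0 hν hc0 hcc hx0 hxm in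
/-- **A generic Holley fact for the `c`-law** `νcx(A)·νc(B) ≤ νc(A′)·νcx(B′)`. -/
theorem cg_fact_cc (P Q P' Q' : Finset V → Prop) [DecidablePred P] [DecidablePred Q]
    [DecidablePred P'] [DecidablePred Q']
    (h : ∀ s ⊆ U, ∀ t ⊆ U, P s → Q t → P' (s ∩ t) ∧ Q' (s ∪ t)) :
    (∑ W ∈ U.powerset.filter P, ν W * c W * x W) * (∑ W ∈ U.powerset.filter Q, ν W * c W) ≤
      (∑ W ∈ U.powerset.filter P', ν W * c W) * (∑ W ∈ U.powerset.filter Q', ν W * c W * x W) := by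
  refine ad_sets_dec U (fun W => ν W * c W * x W) (fun W => ν W * c W) (fun W => ν W * c W)
    (fun W => ν W * c W * x W)
    (fun W => mul_nonneg (mul_nonneg (hν0 W) (hc0 W)) (hx0 W)) (fun W => mul_nonneg (hν0 W) (hc0 W))
    (fun W => mul_nonneg (hν0 W) (hc0 W)) (fun W => mul_nonneg (mul_nonneg (hν0 W) (hc0 W)) (hx0 W))
    P Q P' Q' ?_
  intro s hs t ht hA hB
  refine ⟨(h s hs t ht hA hB).1, (h s hs t ht hA hB).2, ?_⟩
  calc ν s * c s * x s * (ν t * c t) = (ν s * ν t) * (c s * c t) * x s := by ring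
    _ ≤ (ν (s ∩ t) * ν (s ∪ t)) * (c (s ∩ t) * c (s ∪ t)) * x (s ∪ t) :=
        cg_mul3_le (hν s hs t ht) (hcc s t) (hxm s t) (mul_nonneg (hc0 s) (hc0 t)) (hx0 s)
          (mul_nonneg (hν0 _) (hν0 _)) (mul_nonneg (hc0 _) (hc0 _))
    _ = ν (s ∩ t) * c (s ∩ t) * (ν (s ∪ t) * c (s ∪ t) * x (s ∪ t)) := by ring

include hν0 hν hc0 hcc hx0 hy0 hxm hym in
/-- **FKG on the ideal**: `XI·YI ≤ a·XYI`. -/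
theorem cg_fact_fkg_ideal :
    (∑ W ∈ U.powerset.filter (fun W => ¬ ∃ r ∈ ent ∪ ent', r ∈ W), ν W * c W * x W)
      * (∑ W ∈ U.powerset.filter (fun W => ¬ ∃ r ∈ ent ∪ ent', r ∈ W), ν W * c W * y W) ≤
    (∑ W ∈ U.powerset.filter (fun W => ¬ ∃ r ∈ ent ∪ ent', r ∈ W), ν W * c W)
      * (∑ W ∈ U.powerset.filter (fun W => ¬ ∃ r ∈ ent ∪ ent', r ∈ W), ν W * c W * (x W * y W)) := by
  refine ad_sets_dec U (fun W => ν W * c W * x W) (fun W => ν W * c W * y W) (fun W => ν W * c W)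
    (fun W => ν W * c W * (x W * y W))
    (fun W => mul_nonneg (mul_nonneg (hν0 W) (hc0 W)) (hx0 W))
    (fun W => mul_nonneg (mul_nonneg (hν0 W) (hc0 W)) (hy0 W))
    (fun W => mul_nonneg (hν0 W) (hc0 W))
    (fun W => mul_nonneg (mul_nonneg (hν0 W) (hc0 W)) (mul_nonneg (hx0 W) (hy0 W)))
    (fun W => ¬ ∃ r ∈ ent ∪ ent', r ∈ W) (fun W => ¬ ∃ r ∈ ent ∪ ent', r ∈ W)
    (fun W => ¬ ∃ r ∈ ent ∪ ent', r ∈ W) (fun W => ¬ ∃ r ∈ ent ∪ ent', r ∈ W) ?_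
  intro s hs t ht hA hB
  refine ⟨fun ⟨r, hr, hrW⟩ => hA ⟨r, hr, (Finset.mem_inter.1 hrW).1⟩,
    fun ⟨r, hr, hrW⟩ => (Finset.mem_union.1 hrW).elim (fun h => hA ⟨r, hr, h⟩) (fun h => hB ⟨r, hr, h⟩), ?_⟩
  have hyt : y t ≤ y (s ∪ t) := by rw [Finset.union_comm]; exact hym t s
  calc ν s * c s * x s * (ν t * c t * y t) = (ν s * ν t) * (c s * c t) * (x s * y t) := by ring
    _ ≤ (ν (s ∩ t) * ν (s ∪ t)) * (c (s ∩ t) * c (s ∪ t)) * (x (s ∪ t) * y (s ∪ t)) :=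
        cg_mul3_le (hν s hs t ht) (hcc s t) (mul_le_mul (hxm s t) hyt (hy0 t) (hx0 _))
          (mul_nonneg (hc0 s) (hc0 t)) (mul_nonneg (hx0 s) (hy0 t))
          (mul_nonneg (hν0 _) (hν0 _)) (mul_nonneg (hc0 _) (hc0 _))
    _ = ν (s ∩ t) * c (s ∩ t) * (ν (s ∪ t) * c (s ∪ t) * (x (s ∪ t) * y (s ∪ t))) := by ring

end ClosedGateGenFacts

end Summit.Ventures.PercRepro2.Coin
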